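import Mathlib.Analysis.Calculus.FDeriv.Basic
import Mathlib.Analysis.Normed.Operator.Bilinear

/-!
# The definite case of the second-order Lyapunov–Schmidt analysis: the ISOLA CENTRE
# (Kielhöfer 2012, §I.16; Golubitsky–Schaeffer 1985, Ch. II, normal form `x² + λ²`)

Analysis/Calculus proof file (Mathlib only; theorems only, no definitions, no named facts).
Companion of `Literature.Analysis.Calculus.BorderedSecondOrder` (the fold) and
`Literature.Analysis.Calculus.BorderedSecondOrderIndefinite` (the invisible saddle), logically
independent of both, in their common setting: `N u = A u + B u u` is a continuous quadratic map with
linearisation `T = A + B u₀ + B · u₀` at a zero `u₀` of `N + frc c`, `ψ` is a cokernel functional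
(`ψ ∘ T = 0`, `ψ e = 1`), and `(σ, υ)` is a Lyapunov–Schmidt family on the ball of radius `r` around
`(c, 0) ∈ P × ℝ`: `N (υ q) + frc q.1 − σ q • e = 0`, `υ (c, 0) = u₀`, `υ` Fréchet differentiable at
`(c, 0)` with derivative `Dυ`.

Here EVERY parameter direction is invisible at first order (`ψ ∘ frc = 0`; the kernel direction always
is), so that the exact reduced identity reads `σ q = ψ (B z z)`, `z = υ q − u₀`, and the quadratic form
`V ↦ ψ (B (Dυ V) (Dυ V))` on `P × ℝ` is assumed POSITIVE DEFINITE (`≥ κ ‖V‖²`).  Then: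

* `sigma_lower_bound_of_definite` — on a smaller ball, `σ q ≥ (κ/2) ‖q − (c,0)‖²`.  Proof: write
  `z = Dυ V + ρ` with `V = q − (c, 0)` and `‖ρ‖ ≤ δ ‖V‖` (differentiability of `υ` at the centre),
  expand `ψ (B z z)` bilinearly and absorb the three error terms, of size
  `‖ψ‖ ‖B‖ (2 ‖Dυ‖ δ + δ²) ‖V‖²`, into half of `κ ‖V‖²`.
* `sigma_pos_of_definite` — `σ > 0` on the punctured smaller ball;
* `eq_center_of_definite` — the ISOLA CENTRE: the only zero of `σ` in the smaller ball is the centre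
  `(c, 0)` itself.  In applications (`σ q = 0` iff `υ q` solves the uncorrected equation with parameter
  `q.1`, and uniqueness of the family) this says that the solution `u₀` is ISOLATED in parameter ×
  state space: it disappears under every small change of the parameter — the degenerate solution of
  Leray–Schauder index `0` ("ghost").

The negative definite case is the same statement for `(−e, −ψ, −σ)`.  Not here: semi-definite forms
(higher sides of the Newton polygon), kernels of dimension `≥ 2`.

## References

* H. Kielhöfer, *Bifurcation Theory. An Introduction with Applications to Partial Differential
  Equations*, 2nd ed., Applied Mathematical Sciences 156, Springer (2012), §I.16 (degenerate
  bifurcation; isolas). [Kielhofer2012]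
* M. Golubitsky, D. G. Schaeffer, *Singularities and Groups in Bifurcation Theory*, Vol. I,
  Applied Mathematical Sciences 51, Springer (1985), Ch. II (recognition of the normal forms
  `ε x² + δ λ²`; the isola centre `x² + λ²`). [GolubitskySchaeffer1985]
* S.-N. Chow, J. K. Hale, *Methods of Bifurcation Theory*, Grundlehren 251, Springer (1982),
  Ch. 6–7. [ChowHale1982]
-/

noncomputable section

open scoped Topology
open Filter Set Function

namespace Literature.Analysis.Calculus

section SecondOrderDefinite

variable {X Y : Type*} [NormedAddCommGroup X] [NormedSpace ℝ X]
  [NormedAddCommGroup Y] [NormedSpace ℝ Y]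
  {P : Type*} [NormedAddCommGroup P] [NormedSpace ℝ P]

/-- Norm bound for a bilinear map seen through a functional: `|ψ (B x y)| ≤ ‖ψ‖ ‖B‖ ‖x‖ ‖y‖`. [folklore] -/
theorem abs_functional_bilinear_le (ψ : Y →L[ℝ] ℝ) (B : X →L[ℝ] X →L[ℝ] Y) (x y : X) :
    |ψ (B x y)| ≤ ‖ψ‖ * ‖B‖ * ‖x‖ * ‖y‖ := by
  have h1 : |ψ (B x y)| ≤ ‖ψ‖ * ‖B x y‖ := by
    simpa [Real.norm_eq_abs] using ψ.le_opNorm (B x y)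
  have h2 : ‖B x y‖ ≤ ‖B‖ * ‖x‖ * ‖y‖ := B.le_opNorm₂ x y
  calc |ψ (B x y)| ≤ ‖ψ‖ * ‖B x y‖ := h1
    _ ≤ ‖ψ‖ * (‖B‖ * ‖x‖ * ‖y‖) := by gcongr
    _ = ‖ψ‖ * ‖B‖ * ‖x‖ * ‖y‖ := by ring

/-- **Exact reduced identity under full first-order invisibility.**  In the common setting of the
bordered second-order files, if `ψ ∘ frc = 0` then `σ q = ψ (B z z)` with `z = υ q − u₀`, for every `q`
in the ball of the family. [folklore] -/
theorem sigma_eq_of_invisible (A : X →L[ℝ] Y) (B : X →L[ℝ] X →L[ℝ] Y) (T : X →L[ℝ] Y)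
    (frc : P →L[ℝ] Y) (u₀ : X) (c : P) (e : Y) (ψ : Y →L[ℝ] ℝ) (σ : P × ℝ → ℝ)
    (υ : P × ℝ → X) (r : ℝ) (hT : ∀ w, T w = A w + B u₀ w + B w u₀)
    (hψT : ∀ w, ψ (T w) = 0) (hψe : ψ e = 1) (h0 : A u₀ + B u₀ u₀ + frc c = 0)
    (hsol : ∀ q ∈ Metric.ball ((c, 0) : P × ℝ) r,
      A (υ q) + B (υ q) (υ q) + frc q.1 - σ q • e = 0)
    (hinv : ∀ d, ψ (frc d) = 0) (q : P × ℝ) (hq : q ∈ Metric.ball ((c, 0) : P × ℝ) r) :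
    σ q = ψ (B (υ q - u₀) (υ q - u₀)) := by
  set z := υ q - u₀ with hz
  have hυ : υ q = u₀ + z := by rw [hz]; abel
  -- remainder-free quadratic expansion
  have hexp : A (u₀ + z) + B (u₀ + z) (u₀ + z) = (A u₀ + B u₀ u₀) + T z + B z z := by
    rw [hT z]; simp only [map_add, FunLike.coe_add, Pi.add_apply]; abel
  have h1 := hsol q hq
  rw [hυ, hexp] at h1
  -- apply ψ to the equation and to the base equation
  have h2 := congrArg ψ h1
  have h3 := congrArg ψ h0
  simp only [map_add, map_sub, map_smul, hψT, hinv, hψe, smul_eq_mul, mul_one, map_zero,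
    add_zero] at h2 h3
  linarith

/-- **Quadratic lower bound at an isola centre** (Kielhöfer 2012 §I.16; Golubitsky–Schaeffer 1985
Ch. II).  In the common setting of the bordered second-order files, assume full first-order
invisibility `ψ ∘ frc = 0` and that the second-order form is positive definite,
`κ ‖V‖² ≤ ψ (B (Dυ V) (Dυ V))` with `κ > 0`.  Then on some smaller ball around the centre,
`(κ/2) ‖q − (c,0)‖² ≤ σ q`. [folklore] -/
theorem sigma_lower_bound_of_definite (A : X →L[ℝ] Y) (B : X →L[ℝ] X →L[ℝ] Y) (T : X →L[ℝ] Y)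
    (frc : P →L[ℝ] Y) (u₀ : X) (c : P) (e : Y) (ψ : Y →L[ℝ] ℝ) (σ : P × ℝ → ℝ)
    (υ : P × ℝ → X) (Dυ : P × ℝ →L[ℝ] X) (r : ℝ) (hT : ∀ w, T w = A w + B u₀ w + B w u₀)
    (hψT : ∀ w, ψ (T w) = 0) (hψe : ψ e = 1) (h0 : A u₀ + B u₀ u₀ + frc c = 0) (hr : 0 < r)
    (hυ0 : υ (c, 0) = u₀) (hυd : HasFDerivAt υ Dυ (c, 0))
    (hsol : ∀ q ∈ Metric.ball ((c, 0) : P × ℝ) r,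
      A (υ q) + B (υ q) (υ q) + frc q.1 - σ q • e = 0)
    (hinv : ∀ d, ψ (frc d) = 0) (κ : ℝ) (hκ : 0 < κ)
    (hdef : ∀ V : P × ℝ, κ * ‖V‖ ^ 2 ≤ ψ (B (Dυ V) (Dυ V))) :
    ∃ r₁ : ℝ, 0 < r₁ ∧ r₁ ≤ r ∧ ∀ q ∈ Metric.ball ((c, 0) : P × ℝ) r₁,
      κ / 2 * ‖q - (c, 0)‖ ^ 2 ≤ σ q := by
  -- the error budget
  set M : ℝ := ‖ψ‖ * ‖B‖ * (2 * ‖Dυ‖ + 1) with hM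
  have hM0 : 0 ≤ M := by positivity
  set δ : ℝ := min 1 (κ / (2 * (M + 1))) with hδ
  have hδ0 : 0 < δ := lt_min one_pos (by positivity)
  have hδ1 : δ ≤ 1 := min_le_left _ _
  have hMδ : M * δ ≤ κ / 2 := by
    have h1 : δ ≤ κ / (2 * (M + 1)) := min_le_right _ _
    have h2 : M * δ ≤ M * (κ / (2 * (M + 1))) := mul_le_mul_of_nonneg_left h1 hM0
    have h3 : M * (κ / (2 * (M + 1))) ≤ κ / 2 := by
      rw [mul_div_assoc']
      rw [div_le_div_iff₀ (by positivity) (by positivity)]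
      nlinarith
    exact h2.trans h3
  -- differentiability of the family at the centre: ‖υ q − u₀ − Dυ (q − (c,0))‖ ≤ δ ‖q − (c,0)‖ near the centre
  have hlo := (hυd.isLittleO.def hδ0)
  obtain ⟨δ₁, hδ₁, hball⟩ := Metric.eventually_nhds_iff.1 hlo
  refine ⟨min r δ₁, lt_min hr hδ₁, min_le_left _ _, ?_⟩
  intro q hq
  have hqr : q ∈ Metric.ball ((c, 0) : P × ℝ) r := Metric.ball_subset_ball (min_le_left _ _) hq
  have hqδ : dist q (c, 0) < δ₁ := (Metric.mem_ball.1 hq).trans_le (min_le_right _ _)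
  have hρ : ‖υ q - υ (c, 0) - Dυ (q - (c, 0))‖ ≤ δ * ‖q - (c, 0)‖ := hball hqδ
  -- decomposition z = w + ρ
  set V : P × ℝ := q - (c, 0) with hV
  set w : X := Dυ V with hw
  set ρ : X := υ q - u₀ - w with hρdef
  have hz : υ q - u₀ = w + ρ := by rw [hρdef]; abel
  have hρn : ‖ρ‖ ≤ δ * ‖V‖ := by
    have : ρ = υ q - υ (c, 0) - Dυ (q - (c, 0)) := by rw [hρdef, hυ0]
    rw [this]; exact hρ
  have hwn : ‖w‖ ≤ ‖Dυ‖ * ‖V‖ := Dυ.le_opNorm V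
  -- the exact reduced identity and the bilinear expansion
  have hσ : σ q = ψ (B (υ q - u₀) (υ q - u₀)) :=
    sigma_eq_of_invisible A B T frc u₀ c e ψ σ υ r hT hψT hψe h0 hsol hinv q hqr
  have hexp : ψ (B (υ q - u₀) (υ q - u₀)) = ψ (B w w) + ψ (B w ρ) + ψ (B ρ w) + ψ (B ρ ρ) := by
    rw [hz]; simp only [map_add, FunLike.coe_add, Pi.add_apply]; ring
  -- the three error terms
  have hV0 : 0 ≤ ‖V‖ := norm_nonneg _
  have e1 : |ψ (B w ρ)| ≤ ‖ψ‖ * ‖B‖ * ‖Dυ‖ * δ * ‖V‖ ^ 2 := by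
    calc |ψ (B w ρ)| ≤ ‖ψ‖ * ‖B‖ * ‖w‖ * ‖ρ‖ := abs_functional_bilinear_le ψ B w ρ
      _ ≤ ‖ψ‖ * ‖B‖ * (‖Dυ‖ * ‖V‖) * (δ * ‖V‖) := by gcongr
      _ = ‖ψ‖ * ‖B‖ * ‖Dυ‖ * δ * ‖V‖ ^ 2 := by ring
  have e2 : |ψ (B ρ w)| ≤ ‖ψ‖ * ‖B‖ * ‖Dυ‖ * δ * ‖V‖ ^ 2 := by
    calc |ψ (B ρ w)| ≤ ‖ψ‖ * ‖B‖ * ‖ρ‖ * ‖w‖ := abs_functional_bilinear_le ψ B ρ w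
      _ ≤ ‖ψ‖ * ‖B‖ * (δ * ‖V‖) * (‖Dυ‖ * ‖V‖) := by gcongr
      _ = ‖ψ‖ * ‖B‖ * ‖Dυ‖ * δ * ‖V‖ ^ 2 := by ring
  have e3 : |ψ (B ρ ρ)| ≤ ‖ψ‖ * ‖B‖ * δ * δ * ‖V‖ ^ 2 := by
    calc |ψ (B ρ ρ)| ≤ ‖ψ‖ * ‖B‖ * ‖ρ‖ * ‖ρ‖ := abs_functional_bilinear_le ψ B ρ ρ
      _ ≤ ‖ψ‖ * ‖B‖ * (δ * ‖V‖) * (δ * ‖V‖) := by gcongr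
      _ = ‖ψ‖ * ‖B‖ * δ * δ * ‖V‖ ^ 2 := by ring
  have e4 : κ * ‖V‖ ^ 2 ≤ ψ (B w w) := hdef V
  -- total error ≤ M δ ‖V‖² ≤ (κ/2) ‖V‖²
  have hδδ : δ * δ ≤ δ := by nlinarith
  have etot : ‖ψ‖ * ‖B‖ * ‖Dυ‖ * δ * ‖V‖ ^ 2 + ‖ψ‖ * ‖B‖ * ‖Dυ‖ * δ * ‖V‖ ^ 2
      + ‖ψ‖ * ‖B‖ * δ * δ * ‖V‖ ^ 2 ≤ κ / 2 * ‖V‖ ^ 2 := by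
    have hA : 0 ≤ ‖ψ‖ * ‖B‖ := by positivity
    have hV2 : 0 ≤ ‖V‖ ^ 2 := by positivity
    calc ‖ψ‖ * ‖B‖ * ‖Dυ‖ * δ * ‖V‖ ^ 2 + ‖ψ‖ * ‖B‖ * ‖Dυ‖ * δ * ‖V‖ ^ 2
          + ‖ψ‖ * ‖B‖ * δ * δ * ‖V‖ ^ 2
        = (‖ψ‖ * ‖B‖) * (2 * ‖Dυ‖ * δ + δ * δ) * ‖V‖ ^ 2 := by ring
      _ ≤ (‖ψ‖ * ‖B‖) * (2 * ‖Dυ‖ * δ + δ) * ‖V‖ ^ 2 := by gcongr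
      _ = M * δ * ‖V‖ ^ 2 := by rw [hM]; ring
      _ ≤ κ / 2 * ‖V‖ ^ 2 := by gcongr
  have hfin : κ / 2 * ‖V‖ ^ 2 ≤ ψ (B w w) + ψ (B w ρ) + ψ (B ρ w) + ψ (B ρ ρ) := by
    have a1 := neg_abs_le (ψ (B w ρ))
    have a2 := neg_abs_le (ψ (B ρ w))
    have a3 := neg_abs_le (ψ (B ρ ρ))
    nlinarith
  rw [hσ, hexp]
  exact hfin

/-- **`σ > 0` off the centre** (isola centre, Kielhöfer 2012 §I.16): under full first-order invisibility
and a positive definite second-order form, `σ` is strictly positive on a punctured ball around `(c, 0)`.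
[folklore] -/
theorem sigma_pos_of_definite (A : X →L[ℝ] Y) (B : X →L[ℝ] X →L[ℝ] Y) (T : X →L[ℝ] Y)
    (frc : P →L[ℝ] Y) (u₀ : X) (c : P) (e : Y) (ψ : Y →L[ℝ] ℝ) (σ : P × ℝ → ℝ)
    (υ : P × ℝ → X) (Dυ : P × ℝ →L[ℝ] X) (r : ℝ) (hT : ∀ w, T w = A w + B u₀ w + B w u₀)
    (hψT : ∀ w, ψ (T w) = 0) (hψe : ψ e = 1) (h0 : A u₀ + B u₀ u₀ + frc c = 0) (hr : 0 < r)
    (hυ0 : υ (c, 0) = u₀) (hυd : HasFDerivAt υ Dυ (c, 0))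
    (hsol : ∀ q ∈ Metric.ball ((c, 0) : P × ℝ) r,
      A (υ q) + B (υ q) (υ q) + frc q.1 - σ q • e = 0)
    (hinv : ∀ d, ψ (frc d) = 0) (κ : ℝ) (hκ : 0 < κ)
    (hdef : ∀ V : P × ℝ, κ * ‖V‖ ^ 2 ≤ ψ (B (Dυ V) (Dυ V))) :
    ∃ r₁ : ℝ, 0 < r₁ ∧ r₁ ≤ r ∧ ∀ q ∈ Metric.ball ((c, 0) : P × ℝ) r₁, q ≠ (c, 0) → 0 < σ q := by
  obtain ⟨r₁, hr₁, hr₁r, hbound⟩ := sigma_lower_bound_of_definite A B T frc u₀ c e ψ σ υ Dυ r hT hψT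
    hψe h0 hr hυ0 hυd hsol hinv κ hκ hdef
  refine ⟨r₁, hr₁, hr₁r, fun q hq hne => ?_⟩
  have hV : 0 < ‖q - (c, 0)‖ := norm_pos_iff.2 (sub_ne_zero.2 hne)
  have := hbound q hq
  have h2 : 0 < κ / 2 * ‖q - (c, 0)‖ ^ 2 := by positivity
  linarith

/-- **The isola centre is the only zero** (Kielhöfer 2012 §I.16; Golubitsky–Schaeffer 1985 Ch. II,
normal form `x² + λ²`): under full first-order invisibility and a positive definite second-order
form, a zero of `σ` in the smaller ball is the centre `(c, 0)`.  With the uniqueness half of a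
Lyapunov–Schmidt family this is the statement that the underlying solution is ISOLATED in
parameter × state space (it persists under NO small change of the parameter). [folklore] -/
theorem eq_center_of_definite (A : X →L[ℝ] Y) (B : X →L[ℝ] X →L[ℝ] Y) (T : X →L[ℝ] Y)
    (frc : P →L[ℝ] Y) (u₀ : X) (c : P) (e : Y) (ψ : Y →L[ℝ] ℝ) (σ : P × ℝ → ℝ)
    (υ : P × ℝ → X) (Dυ : P × ℝ →L[ℝ] X) (r : ℝ) (hT : ∀ w, T w = A w + B u₀ w + B w u₀)
    (hψT : ∀ w, ψ (T w) = 0) (hψe : ψ e = 1) (h0 : A u₀ + B u₀ u₀ + frc c = 0) (hr : 0 < r)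
    (hυ0 : υ (c, 0) = u₀) (hυd : HasFDerivAt υ Dυ (c, 0))
    (hsol : ∀ q ∈ Metric.ball ((c, 0) : P × ℝ) r,
      A (υ q) + B (υ q) (υ q) + frc q.1 - σ q • e = 0)
    (hinv : ∀ d, ψ (frc d) = 0) (κ : ℝ) (hκ : 0 < κ)
    (hdef : ∀ V : P × ℝ, κ * ‖V‖ ^ 2 ≤ ψ (B (Dυ V) (Dυ V))) :
    ∃ r₁ : ℝ, 0 < r₁ ∧ r₁ ≤ r ∧ ∀ q ∈ Metric.ball ((c, 0) : P × ℝ) r₁, σ q = 0 → q = (c, 0) := by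
  obtain ⟨r₁, hr₁, hr₁r, hpos⟩ := sigma_pos_of_definite A B T frc u₀ c e ψ σ υ Dυ r hT hψT hψe h0 hr
    hυ0 hυd hsol hinv κ hκ hdef
  refine ⟨r₁, hr₁, hr₁r, fun q hq hσ => ?_⟩
  by_contra hne
  have := hpos q hq hne
  linarith

end SecondOrderDefinite

end Literature.Analysis.Calculus

end
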